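import Summits.AtomisticToContinuum.Crystallization.Theorems.ExcessDecayLiouvilleHcpLiouvilleBlowdownLinRows

/-!
# `ExcessDecayLiouville.HcpLiouville` (stmt-AtomisticToContinuum-9332), line `Sketch` (skeleton v4): sub-goal `blowdown_linCaccioppoli`

Part D1 of stub `stub_interior` of the blow-down: the LINEAR Caccioppoli inequality for the force-constant
operator `L` of an admissible two-lattice `S = Sites₀ t A` (`Adm₀ A`, `Inner₀ t A`) satisfying the harmonic
stability inequality `Blowdown.PSIneq κ t A`, for an ARBITRARY field `ζ` (no equation assumed): the truncated row
`Φ_p = Σ_{q ∈ S ∩ B_{ρK}} K(p − q)(ζ p − ζ q)` appears on the right as a work term, so that the assembly of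
`stub_interior` can plug in localised harmonic fields and their lattice differences.  It is an identity plus
`PSIneq` (no absorption): with `ζ̃ = ζ − m₁`, `B = S ∩ B_{ρK}(c)`, the `δ⁻¹`-Lipschitz cut-off
`η = max(0, min(1, (ρ₁ + δ − dist(·,c))/δ))` (`= 1` on `B_{ρ₁}`, `= 0` off `B_{ρ₁+δ}`) and the test field
`w = η ζ̃ 𝟙_S`, the row book-keeping of `…BlowdownLinRows.lean` gives

* `Blowdown.tsum_inner_row_le` —
  `Σ'_p ⟪(L w)_p, w_p⟫ ≤ Σ_{p∈S∩B_{ρ₁+δ}} ‖ζ̃_p‖·‖Φ_p‖ + (K₀/(2δ²) + K₀/δ⁵)·Σ_{p∈B} ‖ζ̃_p‖²`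
  (the commutator symmetrises to `½Σ_{p,q∈B}(η_p − η_q)²⟪K_pq ζ̃_q, ζ̃_p⟫`; far rows `≤ K₀/δ⁵`);
* `Blowdown.nnEnergy_le_nnForm_testField` — read-out `nnEnergy S ζ c (ρ₁ − 2) ≤ nnForm t A w`;
* `blowdown_linCaccioppoli` (registered) with `C = 2K₀`, dividing `κ·nnForm(w) ≤ Σ'_p ⟪(L w)_p, w_p⟫` by `κ`.

All `[folklore]`; a `--supports` helper for item stmt-AtomisticToContinuum-9332, nothing here closes an item.
-/

noncomputable section

namespace Summit.AtomisticToContinuum.Crystallization.Theorems.ExcessDecayLiouville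

open scoped BigOperators Topology Classical InnerProductSpace RealInnerProductSpace
open Literature.MathematicalPhysics.StatisticalMechanics
open Summit.AtomisticToContinuum.Crystallization.Theses.ExcessDecayLiouville
open Summit.AtomisticToContinuum.Crystallization.Theorems.PhononStabilityNegative

namespace Blowdown

open LevelOne

variable {t : Fin 2 → (EuclideanSpace ℝ (Fin 3))}
  {A : (EuclideanSpace ℝ (Fin 3)) →L[ℝ] (EuclideanSpace ℝ (Fin 3))}

/-! ## Assembly of the right-hand side -/

/-- **The right-hand side, finite form**: with `B = S ∩ B_{ρK}(c)` and the test field `w = η(ζ − m₁)` on the sites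
(`0 ≤ η ≤ 1`, `η` `δ⁻¹`-Lipschitz, `η = 0` off `B_{ρ₁+δ}(c)`, `1 ≤ δ`, `ρ₁ + 2δ ≤ ρK`),
`Σ'_p ⟪Σ'_q K_pq(w p − w q), w p⟫ ≤ Σ_{p ∈ S∩B_{ρ₁+δ}} ‖ζ p − m₁‖·‖Σ_{q∈B} K_pq(ζ p − ζ q)‖ + (K₀/(2δ²) + K₀/δ⁵)·Σ_{p∈B} ‖ζ p − m₁‖²`
(row split, the finite part paired with `w p`, symmetrisation of the commutator, far rows). [folklore] -/
theorem tsum_inner_row_le (hA : Adm₀ A) (hI : Inner₀ t A)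
    {ζ w : EuclideanSpace ℝ (Fin 3) → EuclideanSpace ℝ (Fin 3)} {η : EuclideanSpace ℝ (Fin 3) → ℝ}
    {c m₁ : EuclideanSpace ℝ (Fin 3)} {ρ₁ δ ρK : ℝ} (hδ : 1 ≤ δ) (hK : ρ₁ + 2 * δ ≤ ρK)
    (hη0 : ∀ x, 0 ≤ η x) (hη1 : ∀ x, η x ≤ 1) (hηz : ∀ x, ρ₁ + δ < dist x c → η x = 0)
    (hηl : ∀ x y, |η x - η y| ≤ dist x y / δ) (hwS : ∀ p : Sites₀ t A, w p = η p • (ζ p - m₁)) :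
    ∑' p : Sites₀ t A, ⟪∑' q : Sites₀ t A, forceConst ((p : EuclideanSpace ℝ (Fin 3)) - q) (w p - w q), w p⟫ ≤
      ∑ p ∈ (finite_sites_ball hA hI c (ρ₁ + δ)).toFinset, ‖ζ p - m₁‖ *
          ‖∑ q ∈ (finite_sites_ball hA hI c ρK).toFinset,
            forceConst ((p : EuclideanSpace ℝ (Fin 3)) - q) (ζ p - ζ q)‖ +
        (K₀ / δ ^ 2 / 2 + K₀ / δ ^ 5) * ∑ p ∈ (finite_sites_ball hA hI c ρK).toFinset, ‖ζ p - m₁‖ ^ 2 := by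
  have hK₀ := K₀_pos
  have hδ0 : 0 < δ := by linarith
  set P := (finite_sites_ball hA hI c ρK).toFinset with hP
  set P₁ := (finite_sites_ball hA hI c (ρ₁ + δ)).toFinset with hP₁
  have hmemP : ∀ q : Sites₀ t A, q ∈ P ↔ dist (q : EuclideanSpace ℝ (Fin 3)) c ≤ ρK := fun q => by
    rw [hP, Set.Finite.mem_toFinset]; rfl
  have hmemP₁ : ∀ q : Sites₀ t A, q ∈ P₁ ↔ dist (q : EuclideanSpace ℝ (Fin 3)) c ≤ ρ₁ + δ := fun q => by
    rw [hP₁, Set.Finite.mem_toFinset]; rfl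
  have hP₁P : P₁ ⊆ P := fun q hq => (hmemP q).2 (((hmemP₁ q).1 hq).trans (by linarith))
  have hwz : ∀ p : Sites₀ t A, ρ₁ + δ < dist (p : EuclideanSpace ℝ (Fin 3)) c → w p = 0 := fun p hp => by
    rw [hwS p, hηz _ hp, zero_smul]
  have hwfar : ∀ q : Sites₀ t A, ρK < dist (q : EuclideanSpace ℝ (Fin 3)) c → w q = 0 :=
    fun q hq => hwz q (by linarith)
  have hwn : ∀ p : Sites₀ t A, ‖w p‖ ≤ ‖ζ p - m₁‖ := fun p => by
    rw [hwS p, norm_smul, Real.norm_eq_abs, abs_of_nonneg (hη0 _)]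
    exact mul_le_of_le_one_left (norm_nonneg _) (hη1 _)
  -- symmetric pair function
  have hg : ∀ p q : Sites₀ t A,
      ⟪forceConst ((p : EuclideanSpace ℝ (Fin 3)) - q) (ζ q - m₁), ζ p - m₁⟫ =
        ⟪forceConst ((q : EuclideanSpace ℝ (Fin 3)) - p) (ζ p - m₁), ζ q - m₁⟫ := fun p q => by
    rw [forceConst_sub_comm (q : EuclideanSpace ℝ (Fin 3)) p, inner_forceConst_comm]
  -- the outer sum is finite
  have hout : ∑' p : Sites₀ t A,
      ⟪∑' q : Sites₀ t A, forceConst ((p : EuclideanSpace ℝ (Fin 3)) - q) (w p - w q), w p⟫ =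
      ∑ p ∈ P, ⟪∑' q : Sites₀ t A, forceConst ((p : EuclideanSpace ℝ (Fin 3)) - q) (w p - w q), w p⟫ :=
    tsum_eq_sum fun p hp => by
      rw [hwfar p (not_le.1 fun h => hp ((hmemP p).2 h)), inner_zero_right]
  -- row by row
  have hrow : ∀ p ∈ P, ⟪∑' q : Sites₀ t A, forceConst ((p : EuclideanSpace ℝ (Fin 3)) - q) (w p - w q), w p⟫ =
      η p ^ 2 * ⟪∑ q ∈ P, forceConst ((p : EuclideanSpace ℝ (Fin 3)) - q) (ζ p - ζ q), ζ p - m₁⟫ +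
        η p * ∑ q ∈ P, (η p - η q) * ⟪forceConst ((p : EuclideanSpace ℝ (Fin 3)) - q) (ζ q - m₁), ζ p - m₁⟫ +
        ⟪∑' q : Sites₀ t A, (if ρK < dist (q : EuclideanSpace ℝ (Fin 3)) c then
          forceConst ((p : EuclideanSpace ℝ (Fin 3)) - q) (w p) else 0), w p⟫ := by
    intro p _
    rw [row_split hA hI hwfar p, inner_add_left, inner_sum_row_testField hwS P p]
  rw [hout, Finset.sum_congr rfl hrow, Finset.sum_add_distrib, Finset.sum_add_distrib]
  -- (1) the work term
  have h1 : ∑ p ∈ P, η p ^ 2 * ⟪∑ q ∈ P, forceConst ((p : EuclideanSpace ℝ (Fin 3)) - q) (ζ p - ζ q), ζ p - m₁⟫ ≤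
      ∑ p ∈ P₁, ‖ζ p - m₁‖ * ‖∑ q ∈ P, forceConst ((p : EuclideanSpace ℝ (Fin 3)) - q) (ζ p - ζ q)‖ := by
    rw [← Finset.sum_subset hP₁P fun p _ hp₁ => by
      rw [hηz _ (not_le.1 fun h => hp₁ ((hmemP₁ p).2 h))]; ring]
    refine Finset.sum_le_sum fun p _ => ?_
    have hη2 : η p ^ 2 ≤ 1 := pow_le_one₀ (hη0 _) (hη1 _)
    calc η p ^ 2 * ⟪∑ q ∈ P, forceConst ((p : EuclideanSpace ℝ (Fin 3)) - q) (ζ p - ζ q), ζ p - m₁⟫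
        ≤ η p ^ 2 * |⟪∑ q ∈ P, forceConst ((p : EuclideanSpace ℝ (Fin 3)) - q) (ζ p - ζ q), ζ p - m₁⟫| :=
          mul_le_mul_of_nonneg_left (le_abs_self _) (sq_nonneg _)
      _ ≤ 1 * |⟪∑ q ∈ P, forceConst ((p : EuclideanSpace ℝ (Fin 3)) - q) (ζ p - ζ q), ζ p - m₁⟫| :=
          mul_le_mul_of_nonneg_right hη2 (abs_nonneg _)
      _ ≤ _ := by rw [one_mul, mul_comm]; exact abs_real_inner_le_norm _ _
  -- (2) the commutator term
  have h2 : ∑ p ∈ P, η p * ∑ q ∈ P, (η p - η q) *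
      ⟪forceConst ((p : EuclideanSpace ℝ (Fin 3)) - q) (ζ q - m₁), ζ p - m₁⟫ ≤
      K₀ / δ ^ 2 / 2 * ∑ p ∈ P, ‖ζ p - m₁‖ ^ 2 := by
    have h21 : ∑ p ∈ P, η p * ∑ q ∈ P, (η p - η q) *
        ⟪forceConst ((p : EuclideanSpace ℝ (Fin 3)) - q) (ζ q - m₁), ζ p - m₁⟫ =
        ∑ p ∈ P, ∑ q ∈ P, η p * (η p - η q) *
          ⟪forceConst ((p : EuclideanSpace ℝ (Fin 3)) - q) (ζ q - m₁), ζ p - m₁⟫ :=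
      Finset.sum_congr rfl fun p _ => by
        rw [Finset.mul_sum]
        exact Finset.sum_congr rfl fun q _ => by ring
    rw [h21, sum_mul_sub_mul_symm P (fun p : Sites₀ t A => η p)
      (fun p q : Sites₀ t A => ⟪forceConst ((p : EuclideanSpace ℝ (Fin 3)) - q) (ζ q - m₁), ζ p - m₁⟫) hg]
    have h22 := comm_term_le hA hI hδ0 hηl ζ m₁ P
    linarith
  -- (3) the far rows
  have h3 : ∑ p ∈ P, ⟪∑' q : Sites₀ t A, (if ρK < dist (q : EuclideanSpace ℝ (Fin 3)) c then
      forceConst ((p : EuclideanSpace ℝ (Fin 3)) - q) (w p) else 0), w p⟫ ≤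
      K₀ / δ ^ 5 * ∑ p ∈ P, ‖ζ p - m₁‖ ^ 2 := by
    rw [Finset.mul_sum]
    refine Finset.sum_le_sum fun p _ => ?_
    by_cases hpc : dist (p : EuclideanSpace ℝ (Fin 3)) c ≤ ρ₁ + δ
    · have hn := norm_tsum_far_row_le hA hI hδ hK p hpc (w p)
      have h0 : 0 ≤ K₀ / δ ^ 5 := by positivity
      calc ⟪∑' q : Sites₀ t A, (if ρK < dist (q : EuclideanSpace ℝ (Fin 3)) c then
            forceConst ((p : EuclideanSpace ℝ (Fin 3)) - q) (w p) else 0), w p⟫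
          ≤ ‖∑' q : Sites₀ t A, (if ρK < dist (q : EuclideanSpace ℝ (Fin 3)) c then
            forceConst ((p : EuclideanSpace ℝ (Fin 3)) - q) (w p) else 0)‖ * ‖w p‖ := real_inner_le_norm _ _
        _ ≤ K₀ / δ ^ 5 * ‖w p‖ * ‖w p‖ := mul_le_mul_of_nonneg_right hn (norm_nonneg _)
        _ ≤ K₀ / δ ^ 5 * ‖ζ p - m₁‖ * ‖ζ p - m₁‖ := by
          have := hwn p
          have := norm_nonneg (w p)
          gcongr
        _ = K₀ / δ ^ 5 * ‖ζ p - m₁‖ ^ 2 := by ring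
    · rw [hwz p (not_le.1 hpc), inner_zero_right]
      positivity
  have h4 : (K₀ / δ ^ 2 / 2 + K₀ / δ ^ 5) * ∑ p ∈ P, ‖ζ p - m₁‖ ^ 2 =
      K₀ / δ ^ 2 / 2 * ∑ p ∈ P, ‖ζ p - m₁‖ ^ 2 + K₀ / δ ^ 5 * ∑ p ∈ P, ‖ζ p - m₁‖ ^ 2 := by ring
  rw [h4]
  linarith

/-! ## Read-out of the left-hand side -/

/-- **Read-out**: `nnEnergy S ζ c (ρ₁ − 2) ≤ nnForm t A w` for the test field `w = η(ζ − m₁)` on the sites with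
`η = 1` on `B_{ρ₁}(c)` (both ends of every bond counted on the left see `η = 1`) and `η = 0` off `B_{ρ₁+δ}(c)`.
[folklore] -/
theorem nnEnergy_le_nnForm_testField (hA : Adm₀ A) (hI : Inner₀ t A)
    {ζ w : EuclideanSpace ℝ (Fin 3) → EuclideanSpace ℝ (Fin 3)} {η : EuclideanSpace ℝ (Fin 3) → ℝ}
    {c m₁ : EuclideanSpace ℝ (Fin 3)} {ρ₁ δ : ℝ} (hηone : ∀ x, dist x c ≤ ρ₁ → η x = 1)
    (hηz : ∀ x, ρ₁ + δ < dist x c → η x = 0) (hwS : ∀ p : Sites₀ t A, w p = η p • (ζ p - m₁)) :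
    nnEnergy (Sites₀ t A) ζ c (ρ₁ - 2) ≤ nnForm t A w := by
  rw [nnEnergy_eq_tsum_ite]
  have hφ1 : ∀ p : Sites₀ t A, dist (p : EuclideanSpace ℝ (Fin 3)) c ≤ ρ₁ → w p = ζ p - m₁ := fun p hd => by
    rw [hwS p, hηone _ hd, one_smul]
  have hφ0 : ∀ p : Sites₀ t A, ρ₁ + δ < dist (p : EuclideanSpace ℝ (Fin 3)) c → w p = 0 := fun p hd => by
    rw [hwS p, hηz _ hd, zero_smul]
  unfold nnForm
  refine Summable.tsum_le_tsum (fun p => ?_) ?_ ?_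
  · by_cases hpc : dist (p : EuclideanSpace ℝ (Fin 3)) c ≤ ρ₁ - 2
    · rw [if_pos hpc]
      refine (tsum_congr fun q => ?_).le
      by_cases hd : dist (p : EuclideanSpace ℝ (Fin 3)) q ≤ 11 / 10
      · have h4 := dist_triangle (q : EuclideanSpace ℝ (Fin 3)) p c
        rw [dist_comm (q : EuclideanSpace ℝ (Fin 3)) p] at h4
        rw [if_pos hd, if_pos hd, hφ1 p (by linarith), hφ1 q (by linarith), sub_sub_sub_cancel_right]
      · rw [if_neg hd, if_neg hd]
    · rw [if_neg hpc]
      exact tsum_nonneg fun q => by split_ifs <;> positivity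
  · refine summable_of_ne_finset_zero (s := (finite_sites_ball hA hI c (ρ₁ - 2)).toFinset) fun p hp => ?_
    exact if_neg fun h => hp ((Set.Finite.mem_toFinset _).2 h)
  · refine summable_of_ne_finset_zero (s := (finite_sites_ball hA hI c (ρ₁ + δ + 11 / 10)).toFinset)
      fun p hp => ?_
    have hfar : ρ₁ + δ + 11 / 10 < dist (p : EuclideanSpace ℝ (Fin 3)) c :=
      not_le.1 fun h => hp ((Set.Finite.mem_toFinset _).2 h)
    have hφp : w p = 0 := hφ0 p (by linarith)
    refine (tsum_congr fun q => ?_).trans tsum_zero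
    by_cases hd : dist (p : EuclideanSpace ℝ (Fin 3)) q ≤ 11 / 10
    · have h4 := dist_triangle (p : EuclideanSpace ℝ (Fin 3)) q c
      have hφq : w q = 0 := hφ0 q (by linarith)
      rw [if_pos hd, hφp, hφq, sub_zero, norm_zero]
      norm_num
    · rw [if_neg hd]

/-- **The Lipschitz bound of the linear cut-off** `η(x) = max(0, min(1, (ρ₁ + δ − dist(x,c))/δ))`:
`|η x − η y| ≤ dist(x,y)/δ`. [folklore] -/
theorem abs_linCutoff_sub_le (c : EuclideanSpace ℝ (Fin 3)) (ρ₁ : ℝ) {δ : ℝ} (hδ : 0 < δ)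
    (x y : EuclideanSpace ℝ (Fin 3)) :
    |max 0 (min 1 ((ρ₁ + δ - dist x c) / δ)) - max 0 (min 1 ((ρ₁ + δ - dist y c) / δ))| ≤ dist x y / δ := by
  have h1 := abs_max_sub_max_le_max (0 : ℝ) (min 1 ((ρ₁ + δ - dist x c) / δ)) 0 (min 1 ((ρ₁ + δ - dist y c) / δ))
  have h2 := abs_min_sub_min_le_max (1 : ℝ) ((ρ₁ + δ - dist x c) / δ) 1 ((ρ₁ + δ - dist y c) / δ)
  simp only [sub_self, abs_zero] at h1 h2
  have h3 : |(ρ₁ + δ - dist x c) / δ - (ρ₁ + δ - dist y c) / δ| ≤ dist x y / δ := by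
    rw [show (ρ₁ + δ - dist x c) / δ - (ρ₁ + δ - dist y c) / δ = (dist y c - dist x c) / δ by ring, abs_div,
      abs_of_pos hδ]
    exact div_le_div_of_nonneg_right (by rw [dist_comm x y]; exact abs_dist_sub_le y x c) hδ.le
  have h0 : (0 : ℝ) ≤ dist x y / δ := by positivity
  calc |max 0 (min 1 ((ρ₁ + δ - dist x c) / δ)) - max 0 (min 1 ((ρ₁ + δ - dist y c) / δ))|
      ≤ max 0 |min 1 ((ρ₁ + δ - dist x c) / δ) - min 1 ((ρ₁ + δ - dist y c) / δ)| := h1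
    _ ≤ max 0 (max 0 |(ρ₁ + δ - dist x c) / δ - (ρ₁ + δ - dist y c) / δ|) := by gcongr
    _ ≤ dist x y / δ := max_le h0 (max_le h0 h3)

end Blowdown

/-- **Sub-goal `blowdown_linCaccioppoli` (part D1 of stub `stub_interior`, line `Sketch`, skeleton v4)**: the linear
Caccioppoli inequality for the force-constant operator of an admissible two-lattice satisfying `PSIneq κ`, for an
arbitrary field `ζ`, with the truncated row `Σ_{q ∈ S∩B_{ρK}} K(p − q)(ζ p − ζ q)` as a work term; `C = 2K₀`.
[folklore] -/
theorem blowdown_linCaccioppoli : ∃ C : ℝ, ∀ (κ : ℝ) (t : Fin 2 → (EuclideanSpace ℝ (Fin 3))) (A : (EuclideanSpace ℝ (Fin 3)) →L[ℝ] (EuclideanSpace ℝ (Fin 3))), 0 < κ → Adm₀ A → Inner₀ t A → Blowdown.PSIneq κ t A → ∀ (ζ : (EuclideanSpace ℝ (Fin 3)) → (EuclideanSpace ℝ (Fin 3))) (c m₁ : (EuclideanSpace ℝ (Fin 3))) (ρ₁ δ ρK : ℝ), 4 ≤ ρ₁ → 1 ≤ δ → δ ≤ ρ₁ → ρ₁ +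 2 * δ ≤ ρK → Blowdown.nnEnergy (Sites₀ t A) ζ c (ρ₁ - 2) ≤ C / κ * ((δ⁻¹) ^ 2 * Blowdown.oscAt (Sites₀ t A) ζ c ρK m₁ + ∑' p : {s : (EuclideanSpace ℝ (Fin 3)) // s ∈ Sites₀ t A ∧ dist s c ≤ ρ₁ + δ}, ‖ζ p - m₁‖ * ‖∑' q : {s : (EuclideanSpace ℝ (Fin 3)) // s ∈ Sites₀ t A ∧ dist s c ≤ ρK}, forceConst ((p : (EuclideanSpace ℝ (Fin 3))) - q) (ζ p - ζ q)‖) := by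
  refine ⟨2 * LevelOne.K₀, ?_⟩
  intro κ t A hκ hA hI hPS ζ c m₁ ρ₁ δ ρK _hρ₁ hδ _hδρ hK
  have hK₀ := LevelOne.K₀_pos
  have hδ0 : 0 < δ := by linarith
  -- the cut-off and the test field
  obtain ⟨η, hη⟩ : ∃ η : EuclideanSpace ℝ (Fin 3) → ℝ, η = fun x => max 0 (min 1 ((ρ₁ + δ - dist x c) / δ)) :=
    ⟨_, rfl⟩
  obtain ⟨w, hw⟩ : ∃ w : EuclideanSpace ℝ (Fin 3) → EuclideanSpace ℝ (Fin 3),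
      w = fun x => if x ∈ Sites₀ t A then η x • (ζ x - m₁) else 0 := ⟨_, rfl⟩
  have hη0 : ∀ x, 0 ≤ η x := fun x => by rw [hη]; exact le_max_left _ _
  have hη1 : ∀ x, η x ≤ 1 := fun x => by rw [hη]; exact max_le zero_le_one (min_le_left _ _)
  have hηone : ∀ x, dist x c ≤ ρ₁ → η x = 1 := fun x hx => by
    have h1 : 1 ≤ (ρ₁ + δ - dist x c) / δ := by rw [le_div_iff₀ hδ0]; linarith
    rw [hη]
    show max 0 (min 1 ((ρ₁ + δ - dist x c) / δ)) = 1
    rw [min_eq_left h1, max_eq_right zero_le_one]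
  have hηz : ∀ x, ρ₁ + δ < dist x c → η x = 0 := fun x hx => by
    have h1 : (ρ₁ + δ - dist x c) / δ ≤ 0 := div_nonpos_of_nonpos_of_nonneg (by linarith) hδ0.le
    rw [hη]
    show max 0 (min 1 ((ρ₁ + δ - dist x c) / δ)) = 0
    exact max_eq_left ((min_le_right _ _).trans h1)
  have hηl : ∀ x y, |η x - η y| ≤ dist x y / δ := fun x y => by
    rw [hη]; exact Blowdown.abs_linCutoff_sub_le c ρ₁ hδ0 x y
  have hwS : ∀ p : Sites₀ t A, w p = η p • (ζ p - m₁) := fun p => by rw [hw]; exact if_pos p.2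
  have hsub : Function.support w ⊆ Sites₀ t A := fun x hx => by
    by_contra h
    rw [hw] at hx
    exact hx (if_neg h)
  have hfin : (Function.support w).Finite := by
    refine (finite_sites_dist_le hA hI c (ρ₁ + δ)).subset fun x hx => ?_
    have hxS := hsub hx
    refine ⟨hxS, not_lt.1 fun hlt => hx ?_⟩
    show w x = 0
    rw [hwS ⟨x, hxS⟩, hηz x hlt, zero_smul]
  -- the chain of estimates
  have hE := Blowdown.nnEnergy_le_nnForm_testField hA hI hηone hηz hwS
  have hop := Blowdown.mul_nnForm_le_tsum_inner hA hI hPS hfin hsub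
  have hmain := Blowdown.tsum_inner_row_le hA hI hδ hK hη0 hη1 hηz hηl hwS
  -- rewrite the goal in finite form
  rw [Blowdown.tsum_ball_eq_sum hA hI c (ρ₁ + δ) (fun x => ‖ζ x - m₁‖ *
    ‖∑' q : {s : (EuclideanSpace ℝ (Fin 3)) // s ∈ Sites₀ t A ∧ dist s c ≤ ρK},
      forceConst (x - q) (ζ x - ζ q)‖)]
  have hinner : ∀ x : EuclideanSpace ℝ (Fin 3),
      ∑' q : {s : (EuclideanSpace ℝ (Fin 3)) // s ∈ Sites₀ t A ∧ dist s c ≤ ρK}, forceConst (x - q) (ζ x - ζ q) =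
        ∑ q ∈ (LevelOne.finite_sites_ball hA hI c ρK).toFinset,
          forceConst (x - (q : EuclideanSpace ℝ (Fin 3))) (ζ x - ζ q) :=
    fun x => Blowdown.tsum_ball_eq_sum hA hI c ρK (fun y => forceConst (x - y) (ζ x - ζ y))
  simp only [hinner]
  unfold Blowdown.oscAt
  rw [Blowdown.tsum_ball_eq_sum hA hI c ρK (fun x => ‖ζ x - m₁‖ ^ 2)]
  -- arithmetic
  set N := Blowdown.nnEnergy (Sites₀ t A) ζ c (ρ₁ - 2) with hN
  set O := ∑ p ∈ (LevelOne.finite_sites_ball hA hI c ρK).toFinset, ‖ζ p - m₁‖ ^ 2 with hO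
  set Wk := ∑ p ∈ (LevelOne.finite_sites_ball hA hI c (ρ₁ + δ)).toFinset, ‖ζ p - m₁‖ *
    ‖∑ q ∈ (LevelOne.finite_sites_ball hA hI c ρK).toFinset,
      forceConst ((p : EuclideanSpace ℝ (Fin 3)) - q) (ζ p - ζ q)‖ with hWk
  have hO0 : 0 ≤ O := Finset.sum_nonneg fun p _ => sq_nonneg _
  have hWk0 : 0 ≤ Wk := Finset.sum_nonneg fun p _ => mul_nonneg (norm_nonneg _) (norm_nonneg _)
  have hchain : κ * N ≤ Wk + (LevelOne.K₀ / δ ^ 2 / 2 + LevelOne.K₀ / δ ^ 5) * O :=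
    ((mul_le_mul_of_nonneg_left hE hκ.le).trans hop).trans hmain
  have h5 : LevelOne.K₀ / δ ^ 5 ≤ LevelOne.K₀ / δ ^ 2 :=
    div_le_div_of_nonneg_left hK₀.le (by positivity) (pow_le_pow_right₀ hδ (by norm_num))
  have hinv : (δ⁻¹) ^ 2 = 1 / δ ^ 2 := by rw [inv_pow, one_div]
  have hcoef : (LevelOne.K₀ / δ ^ 2 / 2 + LevelOne.K₀ / δ ^ 5) * O ≤ 2 * LevelOne.K₀ * (δ⁻¹) ^ 2 * O := by
    refine mul_le_mul_of_nonneg_right ?_ hO0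
    rw [hinv]
    have h6 : 0 ≤ LevelOne.K₀ / δ ^ 2 := by positivity
    have h7 : 2 * LevelOne.K₀ * (1 / δ ^ 2) = 2 * (LevelOne.K₀ / δ ^ 2) := by ring
    rw [h7]
    linarith
  have hK1 : 1 ≤ 2 * LevelOne.K₀ := by
    unfold LevelOne.K₀; norm_num
  have hWk2 : Wk ≤ 2 * LevelOne.K₀ * Wk := le_mul_of_one_le_left hWk0 hK1
  rw [div_mul_eq_mul_div, le_div_iff₀ hκ]
  calc N * κ = κ * N := mul_comm _ _
    _ ≤ Wk + (LevelOne.K₀ / δ ^ 2 / 2 + LevelOne.K₀ / δ ^ 5) * O := hchain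
    _ ≤ 2 * LevelOne.K₀ * Wk + 2 * LevelOne.K₀ * (δ⁻¹) ^ 2 * O := add_le_add hWk2 hcoef
    _ = 2 * LevelOne.K₀ * ((δ⁻¹) ^ 2 * O + Wk) := by ring

end Summit.AtomisticToContinuum.Crystallization.Theorems.ExcessDecayLiouville

end
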